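import Summits.HubbardSuperconductivity.HubbardLadder.PairCorrParticleHole
import Summits.HubbardSuperconductivity.HubbardLadder.PairCorrSectorRowsUp22TpM1o4
import HarnessLib

/-!
# Pair-channel rows at ELECTRON doping: `P̄_d(4,(2,2)) ≤ 0.8243971` for `hubbardTorusTT' 4 1 (1/4) 8`, `N = 18`

HONEST FRAMING: ladder R1–R4 with certified numbers; no claim on H/H₀. pub-hubbard r3 — the
ELECTRON-DOPED TWIN of the cell's pair-channel rows `PairCorrSectorRowsUp22TpM1o4` (#197), obtained
with ZERO new computation from the particle–hole dictionary `PairCorrParticleHole`: on the `4 × 4`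
torus (even side) `Pᴴ` carries the unit ground states of `hubbardTorusTT' 4 1 (1/4) 8` with `18`
electrons (electron doping `1/8`, `t'/t = +1/4`) onto the unit ground states of
`hubbardTorusTT' 4 1 (-1/4) 8` with `14` electrons (hole doping `1/8`, `t'/t = -1/4`), all `S^z` or
`S^z = 0`, and `P̄_d(4,(2,2); Pᴴψ) = P̄_d(4,(2,2); ψ)` because `(2,2)` is site-disjoint at `L = 4`.
Hence the #197 ceiling `16 · P̄_d(4,(2,2); ψ) ≤ 7973079329042861096893575 / 2⁷⁹` (display
`P̄_d ≤ 0.8243971`) holds verbatim on the electron-doped side, under the SAME two typed claims of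
record (`torusTTUpper_tup_4x4_U8_N14_tpm1o4`, `pairrowsPDDup_engA_4x4_U8_N14_tpm1o4`; reader-certified,
referee-SIGNED replay of #197) and with the same caveats: WEAK (4 × 4 is ED-able; finite torus; the
ceiling is ≈ 60× the float ED value and near-vacuous as a bound — its content is the measured METHOD
CEILING of d2 + eom4, R3-DESIGN §26); no dichotomy attempted; R3 NOT reached; R4 NOT reached.

[cite: QinEtAl2020, §II eqs. (2)–(4)] [cite: LiebWuPhysicaA2003, §1 eq. (3)]
-/

noncomputable section

namespace Summit.HubbardSuperconductivity.HubbardLadder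

open Matrix Literature.Probability.LatticeModels Literature.MathematicalPhysics.QuantumLattice
  HubbardWave0 Summit.HubbardSuperconductivity.HubbardSuperconductivity.Theorems Bounds
  PairChannelParticleHole
open scoped ComplexOrder

/-- **ROW (all `S^z`), electron-doped side**: `16 · P̄_d(4,(2,2); φ) ≤ −claimed.E_cert` for every
normalised `18`-particle ground state `φ` of `hubbardTorusTT' 4 1 (1/4) 8` — the particle–hole image
of #197's row (`Pᴴφ` is a normalised `14`-particle ground state of `hubbardTorusTT' 4 1 (-1/4) 8`, and
`P̄_d(4,(2,2))` is `P`-invariant). TYPED CLAIM hypotheses and caveats exactly as in #197 (WEAK; no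
dichotomy attempted; R3 NOT reached). HONEST FRAMING: ladder R1–R4 with certified numbers; no claim
on H/H₀. [cite: QinEtAl2020, §II eqs. (2)–(4)] [cite: LiebWuPhysicaA2003, §1 eq. (3)] -/
theorem sixteen_mul_avgPairCorr22_le_of_claims_four_N18_U8_tpp1o4
    {φ : Fock (Orb (FermionTorus 2 4))} (hφ : IsGroundState (hubbardTorusTT' 4 1 (1/4) 8) 18 φ)
    (hφ1 : star φ ⬝ᵥ φ = 1) (h : torusTTUpper_tup_4x4_U8_N14_tpm1o4)
    (hc : pairrowsPDDup_engA_4x4_U8_N14_tpm1o4) :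
    16 * avgPairCorr 4 ![2, 2] φ ≤ -((-7973079329042861096893575 : ℝ) / 2 ^ 79) := by
  have hL : Even 4 := ⟨2, rfl⟩
  have hn : ∀ j : Orb (FermionTorus 2 4), ‖((torusStagger (ofLex j).1 : ℤ) : ℂ)‖ = 1 :=
    fun _ => norm_intCast_units _
  have hφ' : IsGroundState (hubbardTorusTT' 4 1 (-(-1/4)) 8) 18 φ := by
    rw [show (-(-1/4) : ℝ) = 1/4 by norm_num]; exact hφ
  have hψ := isGroundState_particleHole_TT' hL 1 (-1/4) 8 (N := 18) (by norm_num) hφ' hφ1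
  rw [show 2 * 4 ^ 2 - 18 = 14 by norm_num] at hψ
  have h1 := sixteen_mul_avgPairCorr22_le_of_claims_four_N14_U8_tpm1o4 hψ
    (by rw [ParticleHole.star_conjTranspose_mulVec_dotProduct _ hn, hφ1]) h hc
  rwa [avgPairCorr_particleHole hL siteDisjoint_four_22] at h1

/-- Display form, outward 7-dp rounding, electron-doped side: `P̄_d(4,(2,2); φ) ≤ 0.8243971` for
every normalised `18`-particle ground state of `hubbardTorusTT' 4 1 (1/4) 8` (all `S^z`). HONEST
FRAMING: ladder R1–R4 with certified numbers; no claim on H/H₀. [cite: QinEtAl2020, §II eqs. (2)–(4)] -/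
theorem avgPairCorr22_le_of_claims_four_N18_U8_tpp1o4_7dp
    {φ : Fock (Orb (FermionTorus 2 4))} (hφ : IsGroundState (hubbardTorusTT' 4 1 (1/4) 8) 18 φ)
    (hφ1 : star φ ⬝ᵥ φ = 1) (h : torusTTUpper_tup_4x4_U8_N14_tpm1o4)
    (hc : pairrowsPDDup_engA_4x4_U8_N14_tpm1o4) :
    avgPairCorr 4 ![2, 2] φ ≤ (0.8243971 : ℝ) := by
  have h1 := sixteen_mul_avgPairCorr22_le_of_claims_four_N18_U8_tpp1o4 hφ hφ1 h hc
  have h2 : -((-7973079329042861096893575 : ℝ) / 2 ^ 79) ≤ 16 * (0.8243971 : ℝ) := by norm_num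
  norm_num at h1 h2 ⊢
  linarith

/-- **`S^z = 0`-SECTOR reading, electron-doped side**: `16 · P̄_d(4,(2,2); φ) ≤ −claimed.E_cert` for
every normalised ground state `φ` of the joint sector `(N = 18, S^z = 0)` of
`hubbardTorusTT' 4 1 (1/4) 8` — the particle–hole image of #197's `S^z = 0` row (`Pᴴ` maps the sector
`(18, 0)` ground states onto the sector `(14, 0)` ground states of `hubbardTorusTT' 4 1 (-1/4) 8`).
TYPED CLAIM hypotheses and caveats exactly as in #197 (WEAK; no dichotomy attempted; R3 NOT reached).
HONEST FRAMING: ladder R1–R4 with certified numbers; no claim on H/H₀.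
[cite: QinEtAl2020, §II eqs. (2)–(4)] [cite: LiebPRL1989, Remark (2)] -/
theorem sixteen_mul_avgPairCorr22_le_of_claims_sz0_four_N18_U8_tpp1o4
    (φ : Fock (Orb (FermionTorus 2 4))) (hφ1 : star φ ⬝ᵥ φ = 1)
    (hgs : IsGroundStateInSector (hubbardTorusTT' 4 1 (1/4) 8) 18 0 φ)
    (h : torusTTUpper_tup_4x4_U8_N14_tpm1o4) (hc : pairrowsPDDup_engA_4x4_U8_N14_tpm1o4) :
    16 * avgPairCorr 4 ![2, 2] φ ≤ -((-7973079329042861096893575 : ℝ) / 2 ^ 79) := by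
  have hL : Even 4 := ⟨2, rfl⟩
  have hn : ∀ j : Orb (FermionTorus 2 4), ‖((torusStagger (ofLex j).1 : ℤ) : ℂ)‖ = 1 :=
    fun _ => norm_intCast_units _
  have hgs' : IsGroundStateInSector (hubbardTorusTT' 4 1 (-(-1/4)) 8) 18 0 φ := by
    rw [show (-(-1/4) : ℝ) = 1/4 by norm_num]; exact hgs
  have hψ := isGroundStateInSector_particleHole_TT' hL 1 (-1/4) 8 (N := 18) (by norm_num) hgs' hφ1
  rw [show 2 * 4 ^ 2 - 18 = 14 by norm_num, neg_zero] at hψ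
  have h1 := sixteen_mul_avgPairCorr22_le_of_claims_sz0_four_N14_U8_tpm1o4 _
    (by rw [ParticleHole.star_conjTranspose_mulVec_dotProduct _ hn, hφ1]) hψ h hc
  rwa [avgPairCorr_particleHole hL siteDisjoint_four_22] at h1

end Summit.HubbardSuperconductivity.HubbardLadder

end
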